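import Summits.QuantumAdvantage.QuantumAdvantage.Theorems.LinnikCubicClassGroupsDegreeOnePrimesEscapeResidueStarkLemma
import Literature.NumberTheory.LFunctions.ClassGroupLFunctionExceptionalZeroQuadraticField
import Literature.NumberTheory.LFunctions.ClassGroupLFunctionExceptionalZeroEffective
import HarnessLib

/-!
# The Brauer–Siegel lower bound at fixed degree, for EVERY number field:
# `κ_K ≥ C(n,ε)·|d_K|^{−ε}` and `h_K R_K ≥ C(n,ε)·|d_K|^{1/2−ε}`

Topic `Summits/QuantumAdvantage/QuantumAdvantage/Theorems`, cell B2b-1 (linnik-cubic), PART A seat 5;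
helper for the crux `DegreeOnePrimesEscape` (stmt-QuantumAdvantage-11543) of route `LinnikCubicClassGroups`
(the residue input R of the log-free zero-density size parameter, qualitatively sharpened from PART B's
`κ_K ≥ c(n)/√|d_K|`, `Residue.residueLowerBound_all`).  HONEST FRAMING: the value of this file is a
THEOREM (kernel-checked; ineffective constants) — NOT summit progress.

* `Residue.residue_ge_rpow_neg (n) (ε)` — **for `n > 1`, `ε > 0` there is `C > 0` (ineffective) with
  `C·|d_K|^{−ε} ≤ κ_K` for EVERY number field `K` of degree `n`** (no normality / subfield hypothesis):
  Stark's Lemma 4 (`Residue.residue_ge_of_zeroFree`: a real-zero-free interval `[1 − c/log|d_K|, 1)`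
  gives `κ_K ≥ e^{−7}16^{−n} c/log|d_K|`) fed with the interval supplied by Siegel's theorem for `ζ_K`
  (`dedekindZetaCont_siegel`, Literature: every real zero has `1 − β ≥ C₀|d_K|^{−ε}`, via Stark's reduction
  of the exceptional zero to a quadratic subfield);
* `Residue.classNumber_mul_regulator_ge (n) (ε)` — the class-number form
  **`C·|d_K|^{1/2−ε} ≤ h_K · R_K`** (Mathlib's class number formula shape of `dedekindZeta_residue`,
  `2^{r₁}(2π)^{r₂} ≤ (2π)^n`, `w_K ≥ 1`; general conversion `classNumber_mul_regulator_ge_of_residue_ge`);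
* `Residue.residue_ge_effective (n)` / `Residue.classNumber_mul_regulator_ge_effective (n)` — **Stark's
  EFFECTIVE theorem for every number field of degree `n`**: `κ_K ≥ c(n)·|d_K|^{−1/n}(log|d_K|)^{−3}` and
  `h_K R_K ≥ c(n)·|d_K|^{1/2−1/n}(log|d_K|)^{−3}`, with NO ineffective input (Stark's Lemma 4 fed with the
  effective repulsion `classGroupLFunction_one_sub_realZero_ge'` of the Literature file
  `ClassGroupLFunctionExceptionalZeroEffective.lean`; cf. [Stark1974, Thm. 1]: `κ_K > c(n) d_K^{−1/n}` up to
  the window factor `g(n) = n!` for non-normal `K`, here with a `(log)³` loss).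

This is the lower-bound half of the Brauer–Siegel theorem for the family of ALL number fields of a fixed
degree ([Stark1974, §1 and (27)]: `κ_K > c₁(1 − β₁)`; Brauer's theorem assumes `K/ℚ` normal).

## References

* H. M. Stark, *Some effective cases of the Brauer–Siegel theorem*, Invent. Math. 23 (1974) 135–152,
  §1, Lemma 4, (27). [Stark1974]
* V. Kumar Murty, *Stark zeros in certain towers of fields*, Math. Res. Lett. 6 (1999), p. 513 (7)–(10).
  [Murty1999StarkZeros]
* H. L. Montgomery, R. C. Vaughan, *Multiplicative Number Theory I*, CUP 2007, Cor. 11.15.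
  [MontgomeryVaughan2007]
-/

noncomputable section

open Complex Filter Topology Set NumberField NumberField.InfinitePlace NumberField.Units
open scoped ComplexOrder

namespace Summit.QuantumAdvantage.QuantumAdvantage.Theorems.DegreeOnePrimesEscape

namespace Residue

open Literature.NumberTheory.LFunctions Literature.NumberTheory.LFunctions.NumberField

/-- **From a residue lower bound to `h_K R_K`** (Mathlib's class number formula shape of
`dedekindZeta_residue`): if `0 ≤ C ≤ κ_K` then `C·√|d_K|/(2π)^n ≤ h_K·R_K` (`2^{r₁}(2π)^{r₂} ≤ (2π)^n`,
`w_K ≥ 1`). [cite: NeukirchANT1999, Ch. VII §5 (5.11)] -/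
theorem classNumber_mul_regulator_ge_of_residue_ge (K : Type) [Field K] [NumberField K] {C : ℝ}
    (hC : 0 ≤ C) (hκ : C ≤ dedekindZeta_residue K) :
    C * Real.sqrt |(discr K : ℝ)| / (2 * Real.pi) ^ Module.finrank ℚ K ≤ (classNumber K : ℝ) * regulator K := by
  set n : ℕ := Module.finrank ℚ K with hn
  have hdpos : 0 < |(discr K : ℝ)| := abs_pos.mpr (Int.cast_ne_zero.mpr (discr_ne_zero K))
  have hsqrt0 : 0 < Real.sqrt |(discr K : ℝ)| := Real.sqrt_pos.mpr hdpos
  rw [dedekindZeta_residue_def] at hκ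
  have hw : (1 : ℝ) ≤ (torsionOrder K : ℝ) := by exact_mod_cast torsionOrder_pos K
  have hden : 0 < (torsionOrder K : ℝ) * Real.sqrt |(discr K : ℝ)| := by positivity
  have hR : 0 < regulator K := regulator_pos K
  have hh : 0 < (classNumber K : ℝ) := by exact_mod_cast classNumber_pos K
  have hpi : (1 : ℝ) ≤ 2 * Real.pi := by have := Real.pi_gt_three; linarith
  have hpi2 : (2 : ℝ) ≤ 2 * Real.pi := by have := Real.pi_gt_three; linarith
  have hsq : 2 * Real.pi ≤ (2 * Real.pi) ^ 2 := le_self_pow₀ hpi (by norm_num)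
  have hgam : (2 : ℝ) ^ nrRealPlaces K * (2 * Real.pi) ^ nrComplexPlaces K ≤ (2 * Real.pi) ^ n := by
    rw [hn, ← card_add_two_mul_card_eq_rank, pow_add, pow_mul]
    exact mul_le_mul (pow_le_pow_left₀ (by norm_num) hpi2 _)
      (pow_le_pow_left₀ (by positivity) hsq _) (by positivity) (by positivity)
  have h1 : C * ((torsionOrder K : ℝ) * Real.sqrt |(discr K : ℝ)|) ≤
      2 ^ nrRealPlaces K * (2 * Real.pi) ^ nrComplexPlaces K * regulator K * classNumber K :=
    (le_div_iff₀ hden).mp hκ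
  have h2 : C * Real.sqrt |(discr K : ℝ)| ≤ C * ((torsionOrder K : ℝ) * Real.sqrt |(discr K : ℝ)|) := by
    calc C * Real.sqrt |(discr K : ℝ)| = C * (1 * Real.sqrt |(discr K : ℝ)|) := by rw [one_mul]
      _ ≤ C * ((torsionOrder K : ℝ) * Real.sqrt |(discr K : ℝ)|) := by gcongr
  have h3 : 2 ^ nrRealPlaces K * (2 * Real.pi) ^ nrComplexPlaces K * regulator K * classNumber K ≤
      (2 * Real.pi) ^ n * (regulator K * classNumber K) := by
    rw [mul_assoc]
    exact mul_le_mul_of_nonneg_right hgam (by positivity)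
  have hpin : 0 < (2 * Real.pi) ^ n := by positivity
  rw [div_le_iff₀ hpin]
  calc C * Real.sqrt |(discr K : ℝ)| ≤ (2 * Real.pi) ^ n * (regulator K * classNumber K) := (h2.trans h1).trans h3
    _ = (classNumber K : ℝ) * regulator K * (2 * Real.pi) ^ n := by ring

/-- **Brauer–Siegel lower bound for the residue, every number field of degree `n`** (ineffective):
for `n > 1` and `ε > 0` there is `C > 0` with `C·|d_K|^{−ε} ≤ κ_K` for every number field `K` of
degree `n`. [cite: Stark1974, Lemma 4 and (27)] [cite: MontgomeryVaughan2007, Corollary 11.15] -/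
theorem residue_ge_rpow_neg (n : ℕ) (hn : 1 < n) {ε : ℝ} (hε : 0 < ε) :
    ∃ C : ℝ, 0 < C ∧ ∀ (K : Type) [Field K] [NumberField K], Module.finrank ℚ K = n →
      C * ((discr K).natAbs : ℝ) ^ (-ε) ≤ dedekindZeta_residue K := by
  obtain ⟨C₀, hC₀, hS⟩ := dedekindZetaCont_siegel n hn hε
  refine ⟨Real.exp (-7) * (1 / 16 : ℝ) ^ n * min (C₀ / 2) (ε / 4), by positivity,
    fun K _ _ hKn => ?_⟩
  have hK : 1 < Module.finrank ℚ K := by rw [hKn]; exact hn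
  set d : ℝ := ((discr K).natAbs : ℝ) with hd
  have hd3 : (3 : ℝ) ≤ d := by rw [hd]; exact_mod_cast three_le_natAbs_discr K hK
  have hd1 : (1 : ℝ) ≤ d := by linarith
  have hlog : 0 < Real.log d := Real.log_pos (by linarith)
  have hdε : 0 < d ^ (-ε) := Real.rpow_pos_of_pos (by linarith) _
  -- the zero-free interval `[1 − c/log d, 1)` with `c = min (C₀ d^{−ε} log d / 2) (1/4)`
  set c : ℝ := min (C₀ * d ^ (-ε) * Real.log d / 2) (1 / 4) with hc
  have hc0 : 0 < c := lt_min (by positivity) (by norm_num)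
  have hc4 : c ≤ 1 / 4 := min_le_right _ _
  have hZ : ∀ σ : ℝ, 1 - c / Real.log d ≤ σ → σ < 1 → dedekindZetaCont K σ ≠ 0 := by
    intro σ hσ hσ1 h0
    have hβ := hS K hKn σ hσ1 h0
    have h1 : c / Real.log d ≤ C₀ * d ^ (-ε) / 2 := by
      rw [div_le_iff₀ hlog]
      have := min_le_left (C₀ * d ^ (-ε) * Real.log d / 2) (1 / 4)
      rw [← hc] at this
      linarith
    have hC₀d : 0 < C₀ * d ^ (-ε) := by positivity
    linarith
  have hmain := residue_ge_of_zeroFree K hK hc0 hc4 hZ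
  -- `c / log d ≥ min (C₀/2) (ε/4) · d^{−ε}`
  have hlogle : Real.log d ≤ d ^ ε / ε := by
    have h := Real.log_le_sub_one_of_pos (Real.rpow_pos_of_pos (by linarith : (0 : ℝ) < d) ε)
    rw [Real.log_rpow (by linarith)] at h
    rw [le_div_iff₀ hε]; linarith
  have hdpos : 0 < d ^ ε := Real.rpow_pos_of_pos (by linarith) ε
  have h2 : min (C₀ / 2) (ε / 4) * d ^ (-ε) ≤ c / Real.log d := by
    rw [le_div_iff₀ hlog]
    rcases le_total (C₀ * d ^ (-ε) * Real.log d / 2) (1 / 4) with hle | hle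
    · rw [hc, min_eq_left hle]
      have : min (C₀ / 2) (ε / 4) * d ^ (-ε) * Real.log d ≤ C₀ / 2 * d ^ (-ε) * Real.log d := by
        gcongr; exact min_le_left _ _
      linarith
    · rw [hc, min_eq_right hle]
      have h3 : ε / 4 * d ^ (-ε) * Real.log d ≤ 1 / 4 := by
        rw [Real.rpow_neg (by linarith)]
        calc ε / 4 * (d ^ ε)⁻¹ * Real.log d ≤ ε / 4 * (d ^ ε)⁻¹ * (d ^ ε / ε) := by gcongr
          _ = 1 / 4 := by field_simp
      have : min (C₀ / 2) (ε / 4) * d ^ (-ε) * Real.log d ≤ ε / 4 * d ^ (-ε) * Real.log d := by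
        gcongr; exact min_le_right _ _
      linarith
  have hpos16 : 0 < Real.exp (-7) * (1 / 16 : ℝ) ^ Module.finrank ℚ K := by positivity
  calc Real.exp (-7) * (1 / 16 : ℝ) ^ n * min (C₀ / 2) (ε / 4) * d ^ (-ε)
      = Real.exp (-7) * (1 / 16 : ℝ) ^ Module.finrank ℚ K * (min (C₀ / 2) (ε / 4) * d ^ (-ε)) := by
        rw [hKn]; ring
    _ ≤ Real.exp (-7) * (1 / 16 : ℝ) ^ Module.finrank ℚ K * (c / Real.log d) :=
        mul_le_mul_of_nonneg_left h2 hpos16.le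
    _ ≤ dedekindZeta_residue K := hmain

/-- **Brauer–Siegel lower bound, class-number form, every number field of degree `n`** (ineffective):
for `n > 1` and `ε > 0` there is `C > 0` with `C·|d_K|^{1/2−ε} ≤ h_K·R_K` for every number field `K`
of degree `n` (`κ_K = 2^{r₁}(2π)^{r₂} h_K R_K/(w_K √|d_K|)`, `2^{r₁}(2π)^{r₂} ≤ (2π)^n`, `w_K ≥ 1`).
[cite: Stark1974, §1] [cite: MontgomeryVaughan2007, Corollary 11.15] -/
theorem classNumber_mul_regulator_ge (n : ℕ) (hn : 1 < n) {ε : ℝ} (hε : 0 < ε) :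
    ∃ C : ℝ, 0 < C ∧ ∀ (K : Type) [Field K] [NumberField K], Module.finrank ℚ K = n →
      C * ((discr K).natAbs : ℝ) ^ (1 / 2 - ε) ≤ (classNumber K : ℝ) * regulator K := by
  obtain ⟨C, hC, h⟩ := residue_ge_rpow_neg n hn hε
  refine ⟨C / (2 * Real.pi) ^ n, by positivity, fun K _ _ hKn => ?_⟩
  have hK : 1 < Module.finrank ℚ K := by rw [hKn]; exact hn
  set d : ℝ := ((discr K).natAbs : ℝ) with hd
  have hd3 : (3 : ℝ) ≤ d := by rw [hd]; exact_mod_cast three_le_natAbs_discr K hK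
  have hd0 : 0 < d := by linarith
  have hdabs : |(discr K : ℝ)| = d := by rw [hd, Nat.cast_natAbs, Int.cast_abs]
  have hmain := classNumber_mul_regulator_ge_of_residue_ge K (by positivity) (h K hKn)
  rw [hdabs, hKn, Real.sqrt_eq_rpow] at hmain
  have h4 : C * d ^ (-ε) * d ^ (1 / 2 : ℝ) = C * d ^ (1 / 2 - ε) := by
    rw [mul_assoc, ← Real.rpow_add hd0]; congr 1; ring_nf
  calc C / (2 * Real.pi) ^ n * d ^ (1 / 2 - ε) = C * d ^ (-ε) * d ^ (1 / 2 : ℝ) / (2 * Real.pi) ^ n := by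
        rw [h4]; ring
    _ ≤ (classNumber K : ℝ) * regulator K := hmain

/-! ### Stark's effective theorem, every number field of degree `n` -/

/-- **Stark's effective lower bound for the residue, every number field of degree `n`.**  For `n > 1`
there is `c > 0` (effective) with `c · |d_K|^{−1/n} · (log|d_K|)^{−3} ≤ κ_K` for every number field `K` of
degree `n`: every real zero `β` of `ζ_K` has `1 − β ≥ δ_K := min(1/(8(2n)! log|d_K|), c₀|d_K|^{−1/n}(log|d_K|)^{−2})`
(`classGroupLFunction_one_sub_realZero_ge'` at `χ = 1`), so `[1 − δ_K/2, 1)` is zero-free and Stark's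
Lemma 4 (`residue_ge_of_zeroFree`) gives `κ_K ≥ e^{−7}16^{−n} δ_K/2`.
[cite: Stark1974, Thm. 1 and Lemma 4] [cite: Murty1999StarkZeros, p. 513 (7)–(10)] -/
theorem residue_ge_effective (n : ℕ) (hn : 1 < n) :
    ∃ c : ℝ, 0 < c ∧ ∀ (K : Type) [Field K] [NumberField K], Module.finrank ℚ K = n →
      c * ((discr K).natAbs : ℝ) ^ (-(1 : ℝ) / n) / Real.log ((discr K).natAbs : ℝ) ^ 3 ≤
        dedekindZeta_residue K := by
  obtain ⟨c₀, hc₀, hZ⟩ := classGroupLFunction_one_sub_realZero_ge'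
  have hfac0 : (0 : ℝ) < ((2 * n).factorial : ℝ) := by exact_mod_cast Nat.factorial_pos _
  refine ⟨Real.exp (-7) * (1 / 16 : ℝ) ^ n * (min (1 / (8 * ((2 * n).factorial : ℝ))) c₀ / 2),
    by positivity, fun K _ _ hKn => ?_⟩
  have hK : 1 < Module.finrank ℚ K := by rw [hKn]; exact hn
  set d : ℝ := ((discr K).natAbs : ℝ) with hd
  have hd3 : (3 : ℝ) ≤ d := by rw [hd]; exact_mod_cast three_le_natAbs_discr K hK
  have hd1 : (1 : ℝ) ≤ d := by linarith
  have hlog3 : 1 < Real.log 3 := by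
    rw [← Real.log_exp 1]
    refine Real.log_lt_log (Real.exp_pos 1) ?_
    have := Real.exp_one_lt_d9; linarith
  have hlog : 1 < Real.log d := hlog3.trans_le (Real.log_le_log (by norm_num) hd3)
  have hlog0 : 0 < Real.log d := by linarith
  have hdn0 : 0 < d ^ (-(1 : ℝ) / n) := Real.rpow_pos_of_pos (by linarith) _
  have hdn1 : d ^ (-(1 : ℝ) / n) ≤ 1 :=
    Real.rpow_le_one_of_one_le_of_nonpos hd1
      (div_nonpos_of_nonpos_of_nonneg (by norm_num) (by positivity))
  -- the repulsion `δ` of every real zero of `ζ_K`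
  set δ : ℝ := min (1 / (8 * ((2 * n).factorial : ℝ) * Real.log d)) (c₀ * d ^ (-(1 : ℝ) / n) / Real.log d ^ 2)
    with hδ
  have hδ0 : 0 < δ := lt_min (by positivity) (by positivity)
  have hδle : δ ≤ 1 / (8 * ((2 * n).factorial : ℝ) * Real.log d) := min_le_left _ _
  have hzero : ∀ β : ℝ, β < 1 → dedekindZetaCont K β = 0 → δ ≤ 1 - β := by
    intro β hβ1 h0
    have hne1 : ((β : ℝ) : ℂ) ≠ 1 := by
      intro h1; apply hβ1.ne; exact_mod_cast h1
    have h := hZ K hK 1 (by ext; simp) β hβ1 (by rwa [classGroupLFunction_one K hne1])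
    rw [hKn] at h
    exact h
  -- the zero-free interval `[1 − c/log d, 1)` with `c = δ log d / 2 ≤ 1/4`
  set c : ℝ := δ * Real.log d / 2 with hc
  have hc0 : 0 < c := by positivity
  have hc4 : c ≤ 1 / 4 := by
    rw [hc]
    have h1 : δ * Real.log d ≤ 1 / (8 * ((2 * n).factorial : ℝ)) := by
      calc δ * Real.log d ≤ 1 / (8 * ((2 * n).factorial : ℝ) * Real.log d) * Real.log d :=
            mul_le_mul_of_nonneg_right hδle hlog0.le
        _ = 1 / (8 * ((2 * n).factorial : ℝ)) := by field_simp
    have hfac1 : (1 : ℝ) ≤ ((2 * n).factorial : ℝ) := by exact_mod_cast Nat.succ_le_of_lt (Nat.factorial_pos _)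
    have h2 : 1 / (8 * ((2 * n).factorial : ℝ)) ≤ 1 / 8 := by
      apply div_le_div_of_nonneg_left (by norm_num) (by norm_num); linarith
    linarith
  have hZF : ∀ σ : ℝ, 1 - c / Real.log d ≤ σ → σ < 1 → dedekindZetaCont K σ ≠ 0 := by
    intro σ hσ hσ1 h0
    have h1 := hzero σ hσ1 h0
    have h2 : c / Real.log d = δ / 2 := by rw [hc]; field_simp
    rw [h2] at hσ
    linarith
  have hmain := residue_ge_of_zeroFree K hK hc0 hc4 hZF
  -- `c/log d = δ/2 ≥ (min(1/(8(2n)!), c₀)/2) · d^{-1/n} / log³ d`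
  have hlog13 : Real.log d ≤ Real.log d ^ 3 := by nlinarith
  have hlog23 : Real.log d ^ 2 ≤ Real.log d ^ 3 := by nlinarith
  have hδge : min (1 / (8 * ((2 * n).factorial : ℝ))) c₀ * d ^ (-(1 : ℝ) / n) / Real.log d ^ 3 ≤ δ := by
    set m : ℝ := min (1 / (8 * ((2 * n).factorial : ℝ))) c₀ with hm
    have hm0 : 0 < m := lt_min (by positivity) hc₀
    rcases le_total (1 / (8 * ((2 * n).factorial : ℝ) * Real.log d)) (c₀ * d ^ (-(1 : ℝ) / n) / Real.log d ^ 2)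
      with hle | hle
    · rw [hδ, min_eq_left hle]
      have h1 : m * d ^ (-(1 : ℝ) / n) ≤ 1 / (8 * ((2 * n).factorial : ℝ)) := by
        calc m * d ^ (-(1 : ℝ) / n) ≤ (1 / (8 * ((2 * n).factorial : ℝ))) * 1 :=
              mul_le_mul (min_le_left _ _) hdn1 hdn0.le (by positivity)
          _ = 1 / (8 * ((2 * n).factorial : ℝ)) := mul_one _
      calc m * d ^ (-(1 : ℝ) / n) / Real.log d ^ 3 ≤ (1 / (8 * ((2 * n).factorial : ℝ))) / Real.log d ^ 3 :=
            div_le_div_of_nonneg_right h1 (by positivity)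
        _ ≤ (1 / (8 * ((2 * n).factorial : ℝ))) / Real.log d :=
            div_le_div_of_nonneg_left (by positivity) hlog0 hlog13
        _ = 1 / (8 * ((2 * n).factorial : ℝ) * Real.log d) := by rw [div_div]
    · rw [hδ, min_eq_right hle]
      have h1 : m * d ^ (-(1 : ℝ) / n) ≤ c₀ * d ^ (-(1 : ℝ) / n) :=
        mul_le_mul_of_nonneg_right (min_le_right _ _) hdn0.le
      calc m * d ^ (-(1 : ℝ) / n) / Real.log d ^ 3 ≤ c₀ * d ^ (-(1 : ℝ) / n) / Real.log d ^ 3 :=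
            div_le_div_of_nonneg_right h1 (by positivity)
        _ ≤ c₀ * d ^ (-(1 : ℝ) / n) / Real.log d ^ 2 :=
            div_le_div_of_nonneg_left (by positivity) (by positivity) hlog23
  have h16 : 0 < Real.exp (-7) * (1 / 16 : ℝ) ^ Module.finrank ℚ K := by positivity
  calc Real.exp (-7) * (1 / 16 : ℝ) ^ n * (min (1 / (8 * ((2 * n).factorial : ℝ))) c₀ / 2) *
        d ^ (-(1 : ℝ) / n) / Real.log d ^ 3
      = Real.exp (-7) * (1 / 16 : ℝ) ^ Module.finrank ℚ K *
          ((min (1 / (8 * ((2 * n).factorial : ℝ))) c₀ * d ^ (-(1 : ℝ) / n) / Real.log d ^ 3) / 2) := by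
        rw [hKn]; ring
    _ ≤ Real.exp (-7) * (1 / 16 : ℝ) ^ Module.finrank ℚ K * (δ / 2) := by gcongr
    _ = Real.exp (-7) * (1 / 16 : ℝ) ^ Module.finrank ℚ K * (c / Real.log d) := by
        congr 1; rw [hc]; field_simp
    _ ≤ dedekindZeta_residue K := hmain

/-- **Stark's effective Brauer–Siegel theorem, class-number form, every number field of degree `n`**:
for `n > 1` there is an effective `c > 0` with `c · |d_K|^{1/2 − 1/n} · (log|d_K|)^{−3} ≤ h_K·R_K` for every
number field `K` of degree `n`. [cite: Stark1974, Thm. 1] [cite: Murty1999StarkZeros, p. 513 (10)] -/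
theorem classNumber_mul_regulator_ge_effective (n : ℕ) (hn : 1 < n) :
    ∃ c : ℝ, 0 < c ∧ ∀ (K : Type) [Field K] [NumberField K], Module.finrank ℚ K = n →
      c * ((discr K).natAbs : ℝ) ^ ((1 : ℝ) / 2 - 1 / n) / Real.log ((discr K).natAbs : ℝ) ^ 3 ≤
        (classNumber K : ℝ) * regulator K := by
  obtain ⟨c, hc, h⟩ := residue_ge_effective n hn
  refine ⟨c / (2 * Real.pi) ^ n, by positivity, fun K _ _ hKn => ?_⟩
  have hK : 1 < Module.finrank ℚ K := by rw [hKn]; exact hn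
  set d : ℝ := ((discr K).natAbs : ℝ) with hd
  have hd3 : (3 : ℝ) ≤ d := by rw [hd]; exact_mod_cast three_le_natAbs_discr K hK
  have hd0 : 0 < d := by linarith
  have hdabs : |(discr K : ℝ)| = d := by rw [hd, Nat.cast_natAbs, Int.cast_abs]
  have hmain := classNumber_mul_regulator_ge_of_residue_ge K (by positivity) (h K hKn)
  rw [hdabs, hKn, Real.sqrt_eq_rpow] at hmain
  have h4 : d ^ (-(1 : ℝ) / n) * d ^ (1 / 2 : ℝ) = d ^ ((1 : ℝ) / 2 - 1 / n) := by
    rw [← Real.rpow_add hd0]; congr 1; ring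
  calc c / (2 * Real.pi) ^ n * d ^ ((1 : ℝ) / 2 - 1 / n) / Real.log d ^ 3
      = c * d ^ (-(1 : ℝ) / n) / Real.log d ^ 3 * d ^ (1 / 2 : ℝ) / (2 * Real.pi) ^ n := by
        rw [← h4]; ring
    _ ≤ (classNumber K : ℝ) * regulator K := hmain

end Residue

end Summit.QuantumAdvantage.QuantumAdvantage.Theorems.DegreeOnePrimesEscape

end
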